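import Mathlib
import Literature.NumberTheory.Rogawski1990.LocalTransfer                            -- ★ `IsRegularElt`, `isRegularElt_iff`
import Summits.HodgeConjecture.HodgeConjecture.Theorems.F0P3cStCharTSCayleyUnitary   -- ★ p849523 `not_isRoot_charpoly_of_irreducible`
import HarnessLib

/-!
# Brick «T3-CENT★» (LH6, package (S-𝔇)∕(T3)): the centraliser of a `3 × 3` matrix with IRREDUCIBLE characteristic polynomial is the field
# `K[A]`, every element of `K[A]` is a scalar or has irreducible characteristic polynomial, and a REGULAR element commuting with `A` has a
# rootless characteristic polynomial

Cell `hodgecm-mathlib`, crux H413 (`stmt-HodgeConjecture-24833`), half A line LH6 (leaf `Cruxes/H413/Lines/F0_P3c_StCharTSPaydown.lean`, organ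
(S-𝔇) `stub_EllipticPackage`, second (T3) conjunct, tree ED. 4 :264–:268: the type-(3) torus `T := centralizer {γ}` of a regular elliptic `γ`); DEAL
«T3-CENT★» of F0P3b-plan (g23) 2026-09-02T05:30:03Z to LH1-p01 (g3); `γ` comes from LH1-p03 (g2)'s «T3-ALG★» (B).  PROOF lane: theorems only (no
`def`, no instance, no notation, no named fact, no `sorry`); pure linear algebra over a field `K`, Mathlib + ★ `Rogawski1990.LocalTransfer` + ★
`F0P3cStCharTSCayleyUnitary`.

ROAD (Z1 in FULL, no fallback): the cyclic-vector argument.  For `A : Matrix (Fin 3) (Fin 3) K` with `Irreducible A.charpoly`: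
* §1 (F) `K[A]` IS A FIELD, as units: `minpoly K A = A.charpoly` (**`minpoly_eq_charpoly`**), a polynomial of degree `< 3` does not kill `A`
  (**`aeval_ne_zero_of_natDegree_lt`**), and every non-zero `q(A)` is a unit (**`isUnit_aeval_of_ne_zero`**: `¬ χ_A ∣ q ⇒ IsCoprime χ_A q`, Mathlib
  `Irreducible.coprime_iff_not_dvd`, then Cayley–Hamilton ★ `Matrix.aeval_self_charpoly`), **`isUnit_of_mem_adjoin_of_ne_zero`**;
* §2 (CYC) every non-zero vector is cyclic: `v, Av, A²v` are linearly independent (a relation is `r(A) v = 0` with `deg r < 3`, so `r(A)` is a unit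
  unless `r = 0`), hence span `K³` — **`exists_aeval_mulVec_eq`**: `∀ w, ∃ q, q(A) v = w`;
* §3 (Z1) **`mem_adjoin_of_commute`**: `Commute A B ⇒ B ∈ Algebra.adjoin K {A}` (`Bv = q₀(A)v`, and `B` commutes with `K[A]`, so `B = q₀(A)` on every
  `q(A)v`); (Z2) **`exists_eq_scalar_or_irreducible_charpoly_of_mem_adjoin`**: `B ∈ K[A] ⇒ B` is a scalar or `χ_B` is irreducible (a reducible cubic
  has a root `c`, an eigenvector `w` of `B`, and `c − B ∈ K[A]` is then a non-unit, i.e. `0`); (Z3) **`not_isRoot_charpoly_of_commute_of_isRegularElt`**: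
  a REGULAR (★ `IsRegularElt`: separable `χ`) `g ∈ GL₃(K)` commuting with `A` has NO eigenvalue in `K` (scalar `c` would give `χ = (X − c)³`, not
  squarefree; otherwise `χ_g` irreducible ⇒ rootless ★ p849523), + the centraliser spelling **`not_isRoot_charpoly_of_mem_centralizer_of_isRegularElt`**
  for `A = ↑γ`, `g ∈ Subgroup.centralizer {γ}` — EXACTLY the second (T3) conjunct for the type-(3) torus `T = centralizer {γ}`.

HONEST LABEL.  Count-neutral kit for the LH6 package (S-𝔇)∕(T3); nothing printed is discharged here.  HC_CM is proved only modulo the 7 printed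
citations (2 remaining: hLiu418 = stmt-HodgeConjecture-24832, h413 = stmt-HodgeConjecture-24833) until rung 0 closes.

## References
* [Rogawski1990] J. D. Rogawski, *Automorphic Representations of Unitary Groups in Three Variables*, Ann. of Math. Stud. 123 (1990) — §3.1 p. 19
  (regular elements), §§3.4–3.6 pp. 23–29 (the tori `T` of `U(3)`; type (3): `T = Res_{E′/F}` of a cubic extension), §12.5–12.6 (elliptic test elements).
  EDITION 2 (docstring-only, lit4 word W-34b, 2026-09-02): the §3.4 and §§3.4–3.6 page pins corrected (p. 23; pp. 23–29); all statements and proofs byte-identical to p849590.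
* N. Jacobson, *Basic Algebra I*, 2nd ed. (1985), §3.10 Thm. 3.16–3.17 (the centraliser of a cyclic matrix is `K[A]`) — folklore linear algebra.
-/

set_option autoImplicit false
set_option linter.dupNamespace false

namespace Summit.HodgeConjecture.HodgeConjecture.Cruxes.H413.F0P3cStCharTSTypeThreeCentralizer

open Matrix Polynomial
open Literature.NumberTheory.Rogawski1990
open Summit.HodgeConjecture.HodgeConjecture.Cruxes.H413.F0P3cStCharTSCayleyUnitary (not_isRoot_charpoly_of_irreducible)

variable {K : Type*} [Field K]

/-! ## §1 (F) `K[A]` is a field: units -/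

section FieldKA

variable {n : Type*} [Fintype n] [DecidableEq n]

/-- **`minpoly K A = χ_A` when `χ_A` is irreducible** (`minpoly ∣ χ_A` ★ Mathlib `Matrix.minpoly_dvd_charpoly`, `minpoly` is not a unit, both monic).
[folklore] -/
theorem minpoly_eq_charpoly [Nonempty n] {A : Matrix n n K} (hA : Irreducible A.charpoly) : minpoly K A = A.charpoly := by
  obtain ⟨r, hr⟩ := Matrix.minpoly_dvd_charpoly A
  rcases hA.isUnit_or_isUnit hr with hu | hu
  · exact absurd hu (minpoly.not_isUnit K A)
  · refine Polynomial.eq_of_monic_of_associated (minpoly.monic (Matrix.isIntegral A)) (Matrix.charpoly_monic A) ⟨hu.unit, ?_⟩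
    rw [IsUnit.unit_spec]
    exact hr.symm

/-- **A non-zero polynomial of degree `< n` does not annihilate `A`** (`χ_A` irreducible: the minimal polynomial has degree `n`). [folklore] -/
theorem aeval_ne_zero_of_natDegree_lt [Nonempty n] {A : Matrix n n K} (hA : Irreducible A.charpoly) {r : K[X]} (hr0 : r ≠ 0)
    (hdeg : r.natDegree < Fintype.card n) : aeval A r ≠ 0 := by
  intro h
  have hdvd := minpoly.dvd K A h
  rw [minpoly_eq_charpoly hA] at hdvd
  have hle := Polynomial.natDegree_le_of_dvd hdvd hr0
  rw [Matrix.charpoly_natDegree_eq_dim] at hle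
  omega

/-- **`K[A]` is a field (unit form): every NON-ZERO `q(A)` is invertible, with inverse again a polynomial in `A`** — `q(A) ≠ 0` gives `¬ χ_A ∣ q`
(Cayley–Hamilton), so `IsCoprime χ_A q` (`χ_A` irreducible, Mathlib `Irreducible.coprime_iff_not_dvd`), i.e. `a χ_A + b q = 1` and `b(A) q(A) = 1`.
[folklore] -/
theorem isUnit_aeval_of_ne_zero {A : Matrix n n K} (hA : Irreducible A.charpoly) (q : K[X]) (hq : aeval A q ≠ 0) : IsUnit (aeval A q) := by
  have hndvd : ¬ A.charpoly ∣ q := by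
    rintro ⟨r, rfl⟩
    exact hq (by rw [map_mul, Matrix.aeval_self_charpoly, zero_mul])
  obtain ⟨a, b, hab⟩ := hA.coprime_iff_not_dvd.2 hndvd
  have h1 : aeval A b * aeval A q = 1 := by
    have h := congrArg (aeval A) hab
    rwa [map_add, map_mul, map_mul, Matrix.aeval_self_charpoly, mul_zero, zero_add, map_one] at h
  have h2 : aeval A q * aeval A b = 1 := by
    rw [← map_mul, mul_comm, map_mul, h1]
  exact ⟨⟨aeval A q, aeval A b, h2, h1⟩, rfl⟩

/-- **Every non-zero element of `K[A] = Algebra.adjoin K {A}` is a unit** (`χ_A` irreducible). [folklore] -/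
theorem isUnit_of_mem_adjoin_of_ne_zero {A : Matrix n n K} (hA : Irreducible A.charpoly) {f : Matrix n n K}
    (hf : f ∈ Algebra.adjoin K {A}) (h0 : f ≠ 0) : IsUnit f := by
  rw [Algebra.adjoin_singleton_eq_range_aeval, AlgHom.mem_range] at hf
  obtain ⟨q, rfl⟩ := hf
  exact isUnit_aeval_of_ne_zero hA q h0

/-- A unit matrix kills no non-zero vector: `u *ᵥ w = 0 ⇒ w = 0`. [folklore] -/
theorem eq_zero_of_isUnit_mulVec_eq_zero {f : Matrix n n K} (hu : IsUnit f) {w : n → K} (hw : f *ᵥ w = 0) : w = 0 := by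
  obtain ⟨u, rfl⟩ := hu
  calc w = ((↑u⁻¹ : Matrix n n K) * (↑u : Matrix n n K)) *ᵥ w := by rw [Units.inv_mul, Matrix.one_mulVec]
    _ = 0 := by rw [← Matrix.mulVec_mulVec, hw, Matrix.mulVec_zero]

end FieldKA

/-! ## §2 (CYC) Every non-zero vector is cyclic for `A` (`3 × 3`, `χ_A` irreducible) -/

section Cyclic

/-- `aeval A (Σ_{j<3} C (c j) X^j) = Σ_j c j • A^j`. [folklore] -/
theorem aeval_sum_C_mul_X_pow (A : Matrix (Fin 3) (Fin 3) K) (c : Fin 3 → K) :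
    aeval A (∑ j : Fin 3, C (c j) * X ^ (j : ℕ)) = ∑ j : Fin 3, c j • A ^ (j : ℕ) := by
  simp only [map_sum, map_mul, aeval_C, map_pow, aeval_X, Algebra.smul_def]

/-- `(Σ_j c j • A^j) *ᵥ v = Σ_j c j • (A^j *ᵥ v)`. [folklore] -/
theorem sum_smul_pow_mulVec (A : Matrix (Fin 3) (Fin 3) K) (c : Fin 3 → K) (v : Fin 3 → K) :
    (∑ j : Fin 3, c j • A ^ (j : ℕ)) *ᵥ v = ∑ j : Fin 3, c j • (A ^ (j : ℕ) *ᵥ v) := by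
  rw [Matrix.sum_mulVec]
  exact Finset.sum_congr rfl fun j _ => Matrix.smul_mulVec _ _ _

/-- **`v, Av, A²v` are linearly independent for every `v ≠ 0`** (`χ_A` irreducible): a linear relation is `r(A) v = 0` with `deg r < 3`, and a non-zero
such `r(A)` is a unit (§1). [folklore] -/
theorem linearIndependent_pow_mulVec {A : Matrix (Fin 3) (Fin 3) K} (hA : Irreducible A.charpoly) {v : Fin 3 → K} (hv : v ≠ 0) :
    LinearIndependent K (fun j : Fin 3 => A ^ (j : ℕ) *ᵥ v) := by
  rw [Fintype.linearIndependent_iff]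
  intro g hg
  set r : K[X] := ∑ j : Fin 3, C (g j) * X ^ (j : ℕ) with hr
  have hrv : aeval A r *ᵥ v = 0 := by
    rw [hr, aeval_sum_C_mul_X_pow, sum_smul_pow_mulVec]
    exact hg
  have hr0 : r = 0 := by
    by_contra hne
    have hdeg : r.natDegree < 3 := by
      have hlt := Polynomial.degree_sum_fin_lt g
      exact (natDegree_lt_iff_degree_lt hne).2 hlt
    have hU : IsUnit (aeval A r) :=
      isUnit_aeval_of_ne_zero hA r (aeval_ne_zero_of_natDegree_lt hA hne (by simpa using hdeg))
    exact hv (eq_zero_of_isUnit_mulVec_eq_zero hU hrv)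
  -- the coefficients of `r = 0` vanish
  intro i
  have hcoeff : r.coeff (i : ℕ) = g i := by
    rw [hr, finsetSum_coeff]
    simp only [coeff_C_mul_X_pow]
    rw [Finset.sum_eq_single i]
    · simp
    · intro j _ hji
      rw [if_neg (fun h => hji (Fin.ext h).symm)]
    · intro hi
      exact absurd (Finset.mem_univ i) hi
  rw [← hcoeff, hr0, coeff_zero]

/-- **CYCLICITY: for `v ≠ 0` every vector is `q(A) v`** (`v, Av, A²v` span `K³`; Mathlib `LinearIndependent.span_eq_top_of_card_eq_finrank`).
[folklore] -/
theorem exists_aeval_mulVec_eq {A : Matrix (Fin 3) (Fin 3) K} (hA : Irreducible A.charpoly) {v : Fin 3 → K} (hv : v ≠ 0) (w : Fin 3 → K) :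
    ∃ q : K[X], aeval A q *ᵥ v = w := by
  have hli := linearIndependent_pow_mulVec hA hv
  have hspan : Submodule.span K (Set.range fun j : Fin 3 => A ^ (j : ℕ) *ᵥ v) = ⊤ :=
    hli.span_eq_top_of_card_eq_finrank (by simp)
  have hw : w ∈ Submodule.span K (Set.range fun j : Fin 3 => A ^ (j : ℕ) *ᵥ v) := by
    rw [hspan]
    exact Submodule.mem_top
  rw [Submodule.mem_span_range_iff_exists_fun] at hw
  obtain ⟨c, hc⟩ := hw
  refine ⟨∑ j : Fin 3, C (c j) * X ^ (j : ℕ), ?_⟩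
  rw [aeval_sum_C_mul_X_pow, sum_smul_pow_mulVec]
  exact hc

end Cyclic

/-! ## §3 (Z1)–(Z3) The centraliser is `K[A]`; its elements are scalars or have irreducible `χ`; regular elements in it are rootless -/

section Centralizer

/-- Polynomials in `A` commute with everything that commutes with `A`. [folklore] -/
theorem aeval_mul_eq_mul_aeval_of_commute {A B : Matrix (Fin 3) (Fin 3) K} (hB : Commute A B) (q : K[X]) :
    aeval A q * B = B * aeval A q := by
  have hA : A ∈ Subalgebra.centralizer K ({B} : Set (Matrix (Fin 3) (Fin 3) K)) := by
    rw [Subalgebra.mem_centralizer_iff]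
    intro b hb
    rw [Set.mem_singleton_iff.1 hb]
    exact hB.eq.symm
  have hle : Algebra.adjoin K {A} ≤ Subalgebra.centralizer K ({B} : Set (Matrix (Fin 3) (Fin 3) K)) :=
    Algebra.adjoin_le (Set.singleton_subset_iff.2 hA)
  have hq := (Subalgebra.mem_centralizer_iff K).1 (hle (Polynomial.aeval_mem_adjoin_singleton K A (p := q))) B rfl
  exact hq.symm

/-- **(Z1) THE CENTRALISER OF `A` IS `K[A]`** (`3 × 3`, `χ_A` irreducible): `Commute A B ⇒ B ∈ Algebra.adjoin K {A}`.  Cyclic-vector proof: with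
`v ≠ 0`, `Bv = q₀(A) v` (§2), and for every `w = q(A) v`: `Bw = q(A) B v = q(A) q₀(A) v = q₀(A) w`, so `B = q₀(A)`.
[cite: Rogawski1990, §3.4 p. 23] -/
theorem mem_adjoin_of_commute {A B : Matrix (Fin 3) (Fin 3) K} (hA : Irreducible A.charpoly) (hB : Commute A B) :
    B ∈ Algebra.adjoin K {A} := by
  -- a non-zero vector
  set v : Fin 3 → K := Pi.single 0 1 with hvdef
  have hv : v ≠ 0 := by
    intro h
    have h0 := congrFun h 0
    simp [hvdef] at h0
  obtain ⟨q₀, hq₀⟩ := exists_aeval_mulVec_eq hA hv (B *ᵥ v)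
  have hBq : B = aeval A q₀ := by
    rw [Matrix.ext_iff_mulVec]
    intro w
    obtain ⟨q, rfl⟩ := exists_aeval_mulVec_eq hA hv w
    calc B *ᵥ (aeval A q *ᵥ v) = (B * aeval A q) *ᵥ v := by rw [Matrix.mulVec_mulVec]
      _ = (aeval A q * B) *ᵥ v := by rw [aeval_mul_eq_mul_aeval_of_commute hB q]
      _ = aeval A q *ᵥ (B *ᵥ v) := by rw [← Matrix.mulVec_mulVec]
      _ = aeval A q *ᵥ (aeval A q₀ *ᵥ v) := by rw [hq₀]
      _ = (aeval A q * aeval A q₀) *ᵥ v := by rw [Matrix.mulVec_mulVec]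
      _ = (aeval A q₀ * aeval A q) *ᵥ v := by rw [← map_mul, mul_comm, map_mul]
      _ = aeval A q₀ *ᵥ (aeval A q *ᵥ v) := by rw [← Matrix.mulVec_mulVec]
  rw [hBq]
  exact Polynomial.aeval_mem_adjoin_singleton K A

/-- Scalar matrices lie in `K[A]`. [folklore] -/
theorem scalar_mem_adjoin (A : Matrix (Fin 3) (Fin 3) K) (c : K) : Matrix.scalar (Fin 3) c ∈ Algebra.adjoin K {A} := by
  rw [Matrix.scalar_apply, ← Matrix.smul_one_eq_diagonal]
  exact Subalgebra.smul_mem _ (Subalgebra.one_mem _) c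

/-- **(Z2) ELEMENTS OF `K[A]` ARE SCALARS OR HAVE IRREDUCIBLE `χ`** (`3 × 3`, `χ_A` irreducible; `[K[A] : K] = 3` is prime): if `χ_B` is reducible it has a
root `c` (cubic), `B` has an eigenvector `w ≠ 0` for `c`, and `c·1 − B ∈ K[A]` kills `w`, so it is not a unit, hence `0` (§1).
[cite: Rogawski1990, §3.4 p. 23] -/
theorem exists_eq_scalar_or_irreducible_charpoly_of_mem_adjoin {A B : Matrix (Fin 3) (Fin 3) K} (hA : Irreducible A.charpoly)
    (hB : B ∈ Algebra.adjoin K {A}) : (∃ c : K, B = Matrix.scalar (Fin 3) c) ∨ Irreducible B.charpoly := by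
  by_cases hirr : Irreducible B.charpoly
  · exact Or.inr hirr
  left
  -- a reducible cubic has a root
  have hroot : ∃ c : K, B.charpoly.IsRoot c := by
    by_contra h
    push Not at h
    exact hirr (Polynomial.irreducible_of_degree_le_three_of_not_isRoot
      (by rw [Matrix.charpoly_natDegree_eq_dim, Finset.mem_Icc]; simp) h)
  obtain ⟨c, hc⟩ := hroot
  refine ⟨c, ?_⟩
  -- an eigenvector of `B` for `c`
  have hdet : (Matrix.scalar (Fin 3) c - B).det = 0 := by
    rw [← Matrix.eval_charpoly]
    exact hc
  obtain ⟨w, hw0, hw⟩ := Matrix.exists_mulVec_eq_zero_iff.2 hdet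
  -- `c·1 − B ∈ K[A]` is not a unit, hence `0`
  have hmem : Matrix.scalar (Fin 3) c - B ∈ Algebra.adjoin K {A} := Subalgebra.sub_mem _ (scalar_mem_adjoin A c) hB
  by_contra hne
  have hU : IsUnit (Matrix.scalar (Fin 3) c - B) :=
    isUnit_of_mem_adjoin_of_ne_zero hA hmem (sub_ne_zero.2 (fun h => hne h.symm))
  exact hw0 (eq_zero_of_isUnit_mulVec_eq_zero hU hw)

/-- (Z2) in the `Commute` spelling: a matrix commuting with `A` is a scalar or has irreducible characteristic polynomial.
[cite: Rogawski1990, §3.4 p. 23] -/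
theorem exists_eq_scalar_or_irreducible_charpoly_of_commute {A B : Matrix (Fin 3) (Fin 3) K} (hA : Irreducible A.charpoly)
    (hB : Commute A B) : (∃ c : K, B = Matrix.scalar (Fin 3) c) ∨ Irreducible B.charpoly :=
  exists_eq_scalar_or_irreducible_charpoly_of_mem_adjoin hA (mem_adjoin_of_commute hA hB)

/-- The characteristic polynomial of a `3 × 3` scalar matrix is `(X − c)³`, which is NOT separable. [folklore] -/
theorem not_separable_charpoly_scalar (c : K) : ¬ (Matrix.scalar (Fin 3) c).charpoly.Separable := by
  intro hsep
  rw [Matrix.scalar_apply, Matrix.charpoly_diagonal, Finset.prod_const, Finset.card_univ, Fintype.card_fin] at hsep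
  have hsq := hsep.squarefree (X - C c) ⟨X - C c, by ring⟩
  exact Polynomial.not_isUnit_X_sub_C c hsq

/-- **(Z3) THE (T3) READ-BACK — a REGULAR element commuting with `A` has NO eigenvalue in `K`.**  For `g ∈ GL₃(K)` with `Commute A ↑g` and ★
`IsRegularElt g` (separable `χ_g`): `χ_g` has no root (scalar `g = c` is excluded since `(X − c)³` is not separable; otherwise `χ_g` is irreducible by
(Z2), hence rootless ★ p849523 `not_isRoot_charpoly_of_irreducible`). [cite: Rogawski1990, §3.1 p. 19; §3.4 p. 23] -/
theorem not_isRoot_charpoly_of_commute_of_isRegularElt {A : Matrix (Fin 3) (Fin 3) K} (hA : Irreducible A.charpoly) (g : GL (Fin 3) K)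
    (hg : Commute A (g : Matrix (Fin 3) (Fin 3) K)) (hreg : IsRegularElt g) (c : K) :
    ¬ (g : Matrix (Fin 3) (Fin 3) K).charpoly.IsRoot c := by
  rcases exists_eq_scalar_or_irreducible_charpoly_of_commute hA hg with ⟨c₀, hc₀⟩ | hirr
  · exfalso
    have hsep := (isRegularElt_iff g).1 hreg
    rw [hc₀] at hsep
    exact not_separable_charpoly_scalar c₀ hsep
  · exact not_isRoot_charpoly_of_irreducible hirr (by simp) c

/-- **(Z3) for the type-(3) torus `T = centralizer {γ}`**: if `γ ∈ GL₃(K)` has IRREDUCIBLE characteristic polynomial, then every REGULAR `g` in the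
centraliser of `γ` has a rootless characteristic polynomial — the second (T3) conjunct of the leaf's `stub_EllipticPackage` for the torus cut out by
LH1-p03's regular elliptic `γ`. [cite: Rogawski1990, §3.1 p. 19; §§3.4–3.6 pp. 23–29] -/
theorem not_isRoot_charpoly_of_mem_centralizer_of_isRegularElt (γ : GL (Fin 3) K)
    (hγ : Irreducible (γ : Matrix (Fin 3) (Fin 3) K).charpoly) {g : GL (Fin 3) K}
    (hg : g ∈ Subgroup.centralizer ({γ} : Set (GL (Fin 3) K))) (hreg : IsRegularElt g) (c : K) :
    ¬ (g : Matrix (Fin 3) (Fin 3) K).charpoly.IsRoot c := by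
  have hcomm : Commute (γ : Matrix (Fin 3) (Fin 3) K) (g : Matrix (Fin 3) (Fin 3) K) := by
    have h := (Subgroup.mem_centralizer_iff.1 hg) γ (Set.mem_singleton γ)
    -- `h : γ * g = g * γ` in `GL`
    have h' := congrArg (fun u : GL (Fin 3) K => (u : Matrix (Fin 3) (Fin 3) K)) h
    simp only [Units.val_mul] at h'
    exact h'
  exact not_isRoot_charpoly_of_commute_of_isRegularElt hγ g hcomm hreg c

/-- **The centraliser of `γ` is commutative-in-`K[γ]`**: every `g` in the centraliser of a `γ` with irreducible `χ_γ` is a polynomial in `γ` (so the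
torus `T = centralizer {γ}` is `K[γ]ˣ`, a cubic field's units — type (3)). [cite: Rogawski1990, §§3.4–3.6 pp. 23–29] -/
theorem coe_mem_adjoin_of_mem_centralizer (γ : GL (Fin 3) K) (hγ : Irreducible (γ : Matrix (Fin 3) (Fin 3) K).charpoly)
    {g : GL (Fin 3) K} (hg : g ∈ Subgroup.centralizer ({γ} : Set (GL (Fin 3) K))) :
    (g : Matrix (Fin 3) (Fin 3) K) ∈ Algebra.adjoin K {(γ : Matrix (Fin 3) (Fin 3) K)} := by
  have h := (Subgroup.mem_centralizer_iff.1 hg) γ (Set.mem_singleton γ)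
  have h' := congrArg (fun u : GL (Fin 3) K => (u : Matrix (Fin 3) (Fin 3) K)) h
  simp only [Units.val_mul] at h'
  exact mem_adjoin_of_commute hγ h'

end Centralizer

end Summit.HodgeConjecture.HodgeConjecture.Cruxes.H413.F0P3cStCharTSTypeThreeCentralizer
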